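import Literature.IUT.LogVolume.GenuineLogTheta
import Literature.IUT.HodgeTheaters.InitialThetaDataPlaces
import Literature.NumberTheory.EllipticCurves.MultiplicativeReductionJValuationProofs
import Literature.NumberTheory.DiophantineGeometry.MinimalDiscriminantProofs
import HarnessLib

/-!
# The genuine Θ-volume input OF a collection of initial Θ-data ([IUTchI] Def. 3.1 ⟶ `ThetaVolumeInput`)
# (route D3 `defn-NegLogThetaAtDatum`, part d: the adapter)

[IUTchI] Def. 3.1 (kurims May-2020 manuscript pp. 61–62): initial Θ-data `(F̄/F, X_F, l, C̲_K, V̲, V^bad_mod, ε̲)`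
with (b) "`F_mod ⊆ F` the field of moduli of `X_F`", "`V^bad_mod ⊆ V_mod` is a nonempty set of nonarchimedean
valuations of `F_mod` … such that `X_F` has bad [i.e., multiplicative] reduction at the elements of `V(F)` that
lie over `V^bad_mod`", (c) "`l ≥ 5` is a prime number", (e) "`V̲ ⊆ V(K)` is a subset that induces a natural
bijection `V̲ ⥲ V_mod`". [IUTchIII] Cor. 3.12 (p. 174): "`|log(q)| > 0` is easily computed in terms of the various
`q`-parameters of the elliptic curve `E_F` … at `v ∈ 𝕍^bad (≠ ∅)`". Dupuy–Hilado §3.3: "`S ⊂ V(ℚ(j_E))` … places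
of bad multiplicative reduction", `ord_v(q_v) = −ord_v(j_E)`.

abc-iut-L5-t2 typed Def. 3.1 REAL as `Literature.IUT.HodgeTheaters.InitialThetaData F K Fbar E l Pb` (field of
moduli `fieldOfModuli E = ℚ(j_E) ⊆ F`, `V^bad_mod`, the section `V̲` with `underline : V_mod → V̲`). The
Literature-level `−|log(Θ)|` of `GenuineLogTheta.lean` is computed from a `ThetaVolumeInput F₀ K`. This file is
the ADAPTER between the two, so that the route's layer-2 statements can quantify over INITIAL Θ-DATA (the printed
object) rather than over a free structure:

* `ThetaData.jMod E` — `j_E` as an element of `F_mod`; `ThetaData.badPrimesMod D` — `V^bad_mod` as a finite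
  set of primes of `𝓞_{F_mod}` (finite by L5-t2's `VbadMod_finite`); `ord_jMod_neg` — **`ord_v(j_E) < 0` at every
  `v ∈ V^bad_mod`**, PROVED: a place of `F` over `v` lies over `V^bad_mod`, so `E_F` has multiplicative reduction
  there (Def. 3.1 (b)), so `ord(j_E) = −ord(Δ_min) < 0` there (Silverman AEC VII.5.1, the tree's
  `log_valuation_j_eq_ordMinimalDiscriminant_of_hasMultiplicativeReductionAt`), and orders over an extension are
  the ramification index times the orders below (Mathlib `valuation_liesOver`);
* `ThetaData.pilotData D : PilotData (fieldOfModuli E)` — c312-3's pilot data `(j_E, S = V^bad_mod, l)` OF `D`;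
* `ThetaData.placeSection D : PlaceSection (fieldOfModuli E) K` — the nonarchimedean part of `V̲ ⥲ V_mod` as a
  section of finite places (`liftPlace v := v̲`; `under_liftPlace`: `v̲ ∩ 𝓞_{F_mod} = v`, from L5-t2's
  `toVMod_underline`);
* `ThetaData.IsVolumeInputOf D I` — the input `I : ThetaVolumeInput (fieldOfModuli E) K` HAS `D`'s pilot data and
  `D`'s section (its ideles — the `q̲_v`-type roots in the completions `K_{v̲}`, [IUTchI] Ex. 3.2 (iv) — are its
  own: they are not part of Def. 3.1);
* `ThetaData.IsP5Choice D` — "“`𝕍^bad_mod`” to be the set `𝕍^bad_mod` of (P5)" ([IUTchIV] Cor. 2.2 (ii) proof,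
  p. 46: the places not dividing `2l` of bad multiplicative reduction), read at the level of `F` exactly as in
  abc-iut-c312-8's point dictionary (`Cor312ProvenancePoint.logq_legendre_eq_logQAvoid`).

[cite: Mochizuki2012, IUTchI Def. 3.1 p. 61–62] [cite: Mochizuki2012, IUTchIV Cor. 2.2 (ii) proof p. 46]
[cite: DupuyHilado2025, §3.3] [claim: Mochizuki2012, status: disputed] for every IUT quotation. Nothing asserted
about any curve; no side taken on [IUTchIII] Cor. 3.12. Deliberately NOT here: the point-level Props over the
`λ`-line (`Cor312AtDatum`, companion `GenuineLogThetaPoint.lean`), the existence of ideles, the summit-side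
identification `negAbsLogQ = −(1/2l)·Cor312Prov.logq D`.
-/

noncomputable section

namespace Literature.IUT.LogVolume

namespace ThetaData

open Literature.IUT.HodgeTheaters NumberField IsDedekindDomain

variable {F K Fbar : Type} [Field F] [NumberField F] [Field K] [NumberField K] [Algebra F K]
  [Field Fbar] [Algebra F Fbar] [Algebra K Fbar] {E : WeierstrassCurve F} [E.IsElliptic] {l : ℕ}
  {Pb : BadPlacePredicates K}

/-! ## `j_E ∈ F_mod` and the bad primes of `F_mod` -/

variable (E) in
/-- `j_E` as an element of the field of moduli `F_mod = ℚ(j_E)` ([IUTchI] Def. 3.1 (b); Dupuy–Hilado §3.3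
"`ℚ(j_E)`"). [cite: Mochizuki2012, IUTchI Def. 3.1 (b) p. 61] -/
def jMod : fieldOfModuli E := ⟨E.j, IntermediateField.mem_adjoin_simple_self ℚ E.j⟩

variable (E) in
/-- `j_E ∈ F_mod` maps to `j_E ∈ F`. [cite: Mochizuki2012, IUTchI Def. 3.1 (b) p. 61] -/
theorem algebraMap_jMod : algebraMap (fieldOfModuli E) F (jMod E) = E.j := rfl

variable (D : InitialThetaData F K Fbar E l Pb)

open scoped Classical in
/-- `V^bad_mod` as a finite set of primes of `𝓞_{F_mod}` (finite by L5-t2's `VbadMod_finite`: the places of `F`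
over it are places of bad reduction). [cite: Mochizuki2012, IUTchI Def. 3.1 (b) p. 61–62] -/
def badPrimesMod : Finset (HeightOneSpectrum (𝓞 (fieldOfModuli E))) :=
  D.VbadMod_finite.toFinset.image FinitePlace.maximalIdeal

/-- Membership: a prime of `𝓞_{F_mod}` is bad iff its finite place lies in `V^bad_mod`.
[cite: Mochizuki2012, IUTchI Def. 3.1 (b) p. 61–62] -/
theorem mem_badPrimesMod_iff (v : HeightOneSpectrum (𝓞 (fieldOfModuli E))) :
    v ∈ badPrimesMod D ↔ FinitePlace.mk v ∈ D.VbadMod := by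
  classical
  simp only [badPrimesMod, Finset.mem_image, Set.Finite.mem_toFinset]
  constructor
  · rintro ⟨u, hu, rfl⟩
    rwa [FinitePlace.mk_maximalIdeal]
  · intro h
    exact ⟨FinitePlace.mk v, h, FinitePlace.maximalIdeal_mk v⟩

/-- `V^bad_mod ≠ ∅` (Def. 3.1 (b) "nonempty"). [cite: Mochizuki2012, IUTchI Def. 3.1 (b) p. 61] -/
theorem badPrimesMod_nonempty : (badPrimesMod D).Nonempty := by
  classical
  obtain ⟨u, hu⟩ := D.VbadMod_nonempty
  exact ⟨u.maximalIdeal, Finset.mem_image_of_mem _ (D.VbadMod_finite.mem_toFinset.mpr hu)⟩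

/-- A finite place of `F` lying over a bad prime of `F_mod` lies in `𝕍(F)^bad = V^bad_mod ×_{V_mod} V(F)`.
[cite: Mochizuki2012, IUTchI Def. 3.1 (b) p. 61–62] -/
theorem mk_mem_VFbad_of_under {x : HeightOneSpectrum (𝓞 F)} {v : HeightOneSpectrum (𝓞 (fieldOfModuli E))}
    (hv : v ∈ badPrimesMod D) (hx : x.under (𝓞 (fieldOfModuli E)) = v) : FinitePlace.mk x ∈ D.VFbad := by
  refine ⟨FinitePlace.mk v, (mem_badPrimesMod_iff D v).mp hv, ?_⟩
  show Val.non (FinitePlace.mk v) = Val.non (FinitePlace.mk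
    ((FinitePlace.maximalIdeal (FinitePlace.mk x)).under (𝓞 (fieldOfModuli E))))
  rw [FinitePlace.maximalIdeal_mk, hx]

/-- Conversely, a finite place of `F` in `𝕍(F)^bad` lies over a bad prime of `F_mod`; together: `x ∈ 𝕍(F)^bad` iff the
prime of `F_mod` under `x` is bad. [cite: Mochizuki2012, IUTchI Def. 3.1 (b) p. 61–62] -/
theorem mk_mem_VFbad_iff (x : HeightOneSpectrum (𝓞 F)) :
    FinitePlace.mk x ∈ D.VFbad ↔ x.under (𝓞 (fieldOfModuli E)) ∈ badPrimesMod D := by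
  constructor
  · rintro ⟨u, hu, hux⟩
    rw [mem_badPrimesMod_iff]
    have h : Val.non u = Val.non (FinitePlace.mk
        ((FinitePlace.maximalIdeal (FinitePlace.mk x)).under (𝓞 (fieldOfModuli E)))) := hux
    rw [FinitePlace.maximalIdeal_mk] at h
    rwa [← Sum.inr_injective h]
  · intro h
    exact mk_mem_VFbad_of_under D h rfl

/-- `E_F` has multiplicative reduction at every place of `F` over a bad prime of `F_mod` (Def. 3.1 (b) "`X_F` has
bad [i.e., multiplicative] reduction at the elements of `V(F)` that lie over `V^bad_mod`").
[cite: Mochizuki2012, IUTchI Def. 3.1 (b) p. 61–62] -/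
theorem hasMultiplicativeReductionAt_of_under {x : HeightOneSpectrum (𝓞 F)}
    {v : HeightOneSpectrum (𝓞 (fieldOfModuli E))} (hv : v ∈ badPrimesMod D)
    (hx : x.under (𝓞 (fieldOfModuli E)) = v) : E.HasMultiplicativeReductionAt x := by
  have h := D.multiplicative_over_VbadMod (FinitePlace.mk x) (mk_mem_VFbad_of_under D hv hx)
  rwa [FinitePlace.maximalIdeal_mk] at h

/-- Over a place of multiplicative reduction, `ord(j_E) = −ord(Δ_min) < 0` (Silverman AEC VII.5.1 (b); the tree's
`log_valuation_j_eq_ordMinimalDiscriminant_of_hasMultiplicativeReductionAt` and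
`ordMinimalDiscriminant_eq_zero_iff_holds`). [cite: SilvermanAEC2009, Prop. VII.5.1(b)] -/
theorem ord_j_neg_of_hasMultiplicativeReductionAt {x : HeightOneSpectrum (𝓞 F)}
    (hx : E.HasMultiplicativeReductionAt x) : ord F x E.j < 0 := by
  have h := E.log_valuation_j_eq_ordMinimalDiscriminant_of_hasMultiplicativeReductionAt x hx
  have hne : E.ordMinimalDiscriminant x ≠ 0 := fun h0 =>
    hx.not_hasGoodReductionAt ((WeierstrassCurve.ordMinimalDiscriminant_eq_zero_iff_holds x E).mp h0)
  unfold ord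
  rw [h]
  have : (0 : ℤ) < E.ordMinimalDiscriminant x := by exact_mod_cast Nat.pos_of_ne_zero hne
  omega

/-- **`ord_v(j_E) < 0` at every `v ∈ V^bad_mod`** — the hypothesis `ord_jE_neg` of c312-3's `PilotData`
(Dupuy–Hilado §3.3 "places of bad multiplicative reduction … `ord_v(q_v) = −ord_v(j_E) > 0`"), PROVED for initial
Θ-data: pick a place `x` of `F` over `v`; `E_F` is multiplicative at `x`; `ord_x(j_E) = e(x|v)·ord_v(j_E) < 0`.
[cite: DupuyHilado2025, §3.3] -/
theorem ord_jMod_neg (v : HeightOneSpectrum (𝓞 (fieldOfModuli E))) (hv : v ∈ badPrimesMod D) :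
    ord (fieldOfModuli E) v (jMod E) < 0 := by
  obtain ⟨x, hx⟩ := PlaceSection.exists_under_eq (F₀ := fieldOfModuli E) (K := F) v
  haveI : x.asIdeal.LiesOver v.asIdeal := ⟨by rw [← hx]; rfl⟩
  have hmult := hasMultiplicativeReductionAt_of_under D hv hx
  have hneg := ord_j_neg_of_hasMultiplicativeReductionAt hmult
  have key : ord F x E.j = (v.asIdeal.ramificationIdx' x.asIdeal : ℤ) * ord (fieldOfModuli E) v (jMod E) := by
    unfold ord
    rw [← algebraMap_jMod E, ← IsDedekindDomain.HeightOneSpectrum.valuation_liesOver F v x (jMod E),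
      WithZero.log_pow]
    ring
  rw [key] at hneg
  have he : (0 : ℤ) ≤ (v.asIdeal.ramificationIdx' x.asIdeal : ℤ) := by positivity
  by_contra hge
  exact absurd hneg (not_lt.mpr (mul_nonneg he (not_lt.mp hge)))

/-! ## The pilot data of `D` -/

/-- **The pilot data `(j_E, S = V^bad_mod, l)` OF the initial Θ-data `D`** over the field of moduli (c312-3's
`PilotData`; Dupuy–Hilado §3.3 with `F = ℚ(j_E)`), every field a projection of `D` or a theorem about it.
[cite: DupuyHilado2025, §3.3] -/
def pilotData : PilotData (fieldOfModuli E) where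
  jE := jMod E
  S := badPrimesMod D
  S_nonempty := badPrimesMod_nonempty D
  ord_jE_neg := ord_jMod_neg D
  l := l
  l_prime := D.l_prime
  five_le_l := D.five_le_l

/-- Its `l` is `D`'s `l`. [cite: Mochizuki2012, IUTchI Def. 3.1 (c) p. 61] -/
theorem pilotData_l : (pilotData D).l = l := rfl

/-- Its bad set is `V^bad_mod`. [cite: Mochizuki2012, IUTchI Def. 3.1 (b) p. 61] -/
theorem pilotData_S : (pilotData D).S = badPrimesMod D := rfl

/-- Its `j`-invariant is `j_E`. [cite: Mochizuki2012, IUTchI Def. 3.1 (b) p. 61] -/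
theorem pilotData_jE : (pilotData D).jE = jMod E := rfl

/-! ## The section of finite places of `D` -/

/-- The element `v̲ ∈ V̲` over a NONARCHIMEDEAN `v ∈ V_mod` is nonarchimedean (restriction preserves the kind,
L5-t2's `isNon_restrict_iff`). [cite: Mochizuki2012, IUTchI Def. 3.1 (e) p. 62] -/
theorem isNon_underline_non (u : FinitePlace (fieldOfModuli E)) : (D.underline (Val.non u)).IsNon := by
  have h := D.toVMod_underline (Val.non u)
  have h2 : (toVMod F K E (D.underline (Val.non u))).IsNon := by rw [h]; rfl
  exact (Val.isNon_restrict_iff _ _).mp ((Val.isNon_restrict_iff _ _).mp h2)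

/-- **`v̲` as a prime of `𝓞_K`**: the finite place of `K` in `V̲` over the finite place `v` of `F_mod`
(L5-t2's `underline`, read on finite places). [cite: Mochizuki2012, IUTchI Def. 3.1 (e) p. 62] -/
def liftPlace (v : HeightOneSpectrum (𝓞 (fieldOfModuli E))) : HeightOneSpectrum (𝓞 K) :=
  FinitePlace.maximalIdeal
    (Sum.getRight (D.underline (Val.non (FinitePlace.mk v))) (isNon_underline_non D (FinitePlace.mk v)))

/-- `v̲ ∈ V̲` is the valuation of `liftPlace v`. [cite: Mochizuki2012, IUTchI Def. 3.1 (e) p. 62] -/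
theorem underline_eq_non_liftPlace (v : HeightOneSpectrum (𝓞 (fieldOfModuli E))) :
    D.underline (Val.non (FinitePlace.mk v)) = Val.non (FinitePlace.mk (liftPlace D v)) := by
  rw [liftPlace, FinitePlace.mk_maximalIdeal]
  exact (Sum.inr_getRight _ _).symm

/-- **`v̲ ∩ 𝓞_{F_mod} = v`**: the lift is a section of the restriction of finite places (from "`V̲ ⥲ V_mod`",
L5-t2's `toVMod_underline`). [cite: Mochizuki2012, IUTchI Def. 3.1 (e) p. 62] -/
theorem under_liftPlace (v : HeightOneSpectrum (𝓞 (fieldOfModuli E))) :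
    (liftPlace D v).under (𝓞 (fieldOfModuli E)) = v := by
  have h := D.toVMod_underline (Val.non (FinitePlace.mk v))
  rw [underline_eq_non_liftPlace] at h
  -- unfold the two restrictions on a nonarchimedean valuation
  have h2 : FinitePlace.mk ((FinitePlace.maximalIdeal (FinitePlace.mk
      ((FinitePlace.maximalIdeal (FinitePlace.mk (liftPlace D v))).under (𝓞 F)))).under
        (𝓞 (fieldOfModuli E))) = FinitePlace.mk v :=
    Sum.inr_injective h
  rw [FinitePlace.maximalIdeal_mk, FinitePlace.maximalIdeal_mk] at h2
  have h3 := congrArg FinitePlace.maximalIdeal h2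
  rw [FinitePlace.maximalIdeal_mk, FinitePlace.maximalIdeal_mk] at h3
  refine Eq.trans ?_ h3
  ext1
  simp only [HeightOneSpectrum.under_asIdeal]
  rw [Ideal.under_under]

/-- **The section of finite places OF `D`**: `v ↦ v̲` ([IUTchI] Def. 3.1 (e), nonarchimedean part) as a
`PlaceSection (fieldOfModuli E) K`. [cite: Mochizuki2012, IUTchI Def. 3.1 (e) p. 62] -/
def placeSection : PlaceSection (fieldOfModuli E) K where
  lift := liftPlace D
  under_lift := under_liftPlace D

/-- Its lift is `liftPlace`. [cite: Mochizuki2012, IUTchI Def. 3.1 (e) p. 62] -/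
theorem placeSection_lift (v : HeightOneSpectrum (𝓞 (fieldOfModuli E))) :
    (placeSection D).lift v = liftPlace D v := rfl

/-! ## Volume inputs of `D`; the (P5) choice -/

/-- **`I` is a genuine Θ-volume input OF the initial Θ-data `D`**: its pilot data are `D`'s `(j_E, V^bad_mod, l)` and
its section of places is `D`'s `V̲` (nonarchimedean part). Its ideles (units of the completions `K_{v̲}` with the
pilot valuations — the `q̲_v = q_v^{1/2l}` of [IUTchI] Ex. 3.2 (iv)) are not part of Def. 3.1 and stay the input's
own. [cite: Mochizuki2012, IUTchI Def. 3.1 p. 61–62] -/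
structure IsVolumeInputOf (I : ThetaVolumeInput (fieldOfModuli E) K) : Prop where
  /-- the pilot data are `D`'s -/
  X_eq : I.X = pilotData D
  /-- the section of finite places is `D`'s `V̲` -/
  σ_eq : I.σ = placeSection D

/-- For a volume input of `D`, `l` is `D`'s. [cite: Mochizuki2012, IUTchI Def. 3.1 (c) p. 61] -/
theorem IsVolumeInputOf.l_eq {I : ThetaVolumeInput (fieldOfModuli E) K} (h : IsVolumeInputOf D I) : I.l = l := by
  rw [ThetaVolumeInput.l, h.X_eq]
  rfl

/-- For a volume input of `D`, `−|log(q)| = −deĝ̲(P_q)` of `D`'s pilot data over `F_mod`.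
[cite: Mochizuki2012, IUTchIV Thm. 1.10 p. 23] -/
theorem IsVolumeInputOf.negAbsLogQ_eq {I : ThetaVolumeInput (fieldOfModuli E) K} (h : IsVolumeInputOf D I) :
    I.negAbsLogQ = -FinDivisor.ndeg (fieldOfModuli E) (pilotData D).qPilot := by
  rw [ThetaVolumeInput.negAbsLogQ, h.X_eq]

/-- **The (P5) choice of `𝕍^bad_mod`** ([IUTchIV] Cor. 2.2 (ii) proof, p. 46: "“`𝕍^bad_mod`” to be the set `𝕍^bad_mod`
of (P5)" = "the nonarchimedean valuations … that do not divide `2l` and at which `E_F` has bad multiplicative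
reduction"), read at the level of `F` exactly as in abc-iut-c312-8's point dictionary: a finite place of `F` lies
over `V^bad_mod` iff it divides neither `2` nor `l` and `E_F` has multiplicative reduction there.
[cite: Mochizuki2012, IUTchIV Cor. 2.2 (ii) proof p. 46] -/
def IsP5Choice : Prop :=
  ∀ v : FinitePlace F, v ∈ D.VFbad ↔
    (∀ p ∈ ({2, l} : Finset ℕ), ((p : ℕ) : 𝓞 F) ∉ v.maximalIdeal.asIdeal) ∧
      E.HasMultiplicativeReductionAt v.maximalIdeal

/-! ## Ideles over the genuine completions of `D`, and the volume input they determine -/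

/-- **Idele data for `D`**: units `t_{Θ,j,v}`, `t_{q,v}` of the GENUINE completions `K_{v̲}` (`v̲ = liftPlace D v`) with
the pilot valuations of `D`'s pilot data — the `q̲_v = q_v^{1/2l}`-type roots of [IUTchI] Ex. 3.2 (iv) realised in
`K_{v̲}` (Dupuy–Hilado §3.9 "let `a = (a_{v̲}) ∈ 𝔸_{V̲}` be such that `D = div(a)`"). INPUT: their existence (Tate
uniformisation + the `E[2l]`-structure of the fields of initial Θ-data) is not proved here.
[cite: Mochizuki2012, IUTchI Ex. 3.2 (iv) p. 71] -/
structure IdeleData : Type where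
  /-- the Θ-idele `t_{Θ,j,v} ∈ K_{v̲}^×` -/
  tΘ : ∀ (p : ℕ) (hp : p.Prime), Fin (pilotData D).lstar → (v : placesOver (fieldOfModuli E) p) →
    (@LocalFields.k (fieldOfModuli E) _ _ p ⟨hp⟩ ((placeSection D).localFieldFamily p hp) v)ˣ
  /-- it realises `P_Θ` -/
  tΘ_ord : ∀ (p : ℕ) (hp : p.Prime) (i : Fin (pilotData D).lstar) (v : placesOver (fieldOfModuli E) p),
    @LocalFields.ordv (fieldOfModuli E) _ _ p ⟨hp⟩ ((placeSection D).localFieldFamily p hp) v (tΘ p hp i v) =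
      (pilotData D).thetaPilot i v.1
  /-- the `q`-idele `t_{q,v} ∈ K_{v̲}^×` -/
  tq : ∀ (p : ℕ) (hp : p.Prime), Fin (pilotData D).lstar → (v : placesOver (fieldOfModuli E) p) →
    (@LocalFields.k (fieldOfModuli E) _ _ p ⟨hp⟩ ((placeSection D).localFieldFamily p hp) v)ˣ
  /-- it realises `P_q` -/
  tq_ord : ∀ (p : ℕ) (hp : p.Prime) (i : Fin (pilotData D).lstar) (v : placesOver (fieldOfModuli E) p),
    @LocalFields.ordv (fieldOfModuli E) _ _ p ⟨hp⟩ ((placeSection D).localFieldFamily p hp) v (tq p hp i v) =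
      (pilotData D).qPilot v.1

/-- **The genuine Θ-volume input OF `D` determined by idele data**: `D`'s pilot data, `D`'s section `V̲`, and the
given ideles. [cite: Mochizuki2012, IUTchI Def. 3.1 p. 61–62] -/
def volumeInputOf (r : IdeleData D) : ThetaVolumeInput (fieldOfModuli E) K where
  X := pilotData D
  σ := placeSection D
  tΘ := r.tΘ
  tΘ_ord := r.tΘ_ord
  tq := r.tq
  tq_ord := r.tq_ord

/-- The input determined by idele data IS a volume input of `D`. [cite: Mochizuki2012, IUTchI Def. 3.1 p. 61–62] -/
theorem isVolumeInputOf_volumeInputOf (r : IdeleData D) : IsVolumeInputOf D (volumeInputOf D r) := ⟨rfl, rfl⟩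

/-- Conversely every volume input of `D` is `volumeInputOf D r` for the idele data `r` it carries.
[cite: Mochizuki2012, IUTchI Def. 3.1 p. 61–62] -/
theorem exists_eq_volumeInputOf {I : ThetaVolumeInput (fieldOfModuli E) K} (h : IsVolumeInputOf D I) :
    ∃ r : IdeleData D, I = volumeInputOf D r := by
  obtain ⟨X, σ, tΘ, tΘ_ord, tq, tq_ord⟩ := I
  obtain ⟨hX, hσ⟩ := h
  simp only at hX hσ
  subst hX hσ
  exact ⟨⟨tΘ, tΘ_ord, tq, tq_ord⟩, rfl⟩

end ThetaData

end Literature.IUT.LogVolume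

end
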